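import Summits.CriticalPhenomena.PercolationContinuityZ3.Theorems.PercNearOneGluingNoHeavyLowerTailSahiE3BlockOrStep
import Summits.CriticalPhenomena.PercolationContinuityZ3.Theorems.PercNearOneGluingNoHeavyLowerTailSahiE3LroTransport
import Mathlib.Data.Fin.Tuple.Basic
import Mathlib.Algebra.BigOperators.Fin
import Mathlib.Tactic.Linarith
import Mathlib.Tactic.Ring
import HarnessLib
import HarnessLib.Audit

/-!
# `NoHeavyLowerTail` (crux stmt-CriticalPhenomena-4575), Sahi programme P4: the certificate of `⋁ᵢ (x_{Bᵢ} = ⊤) ∨ G`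
# (OR of the tops of finitely many Harris blocks over a certified base)

Support file (cell `prim-l12`, seat P4, generation 15; `--supports stmt-CriticalPhenomena-4575`).  No named facts, no sorries;
standard axioms; def-free.

`cert_blocks_over`: given an exactly certified base `(Q, ν_Q, G)` (hypotheses of `cert_or_step`) and finitely many blocks
`B₀, …, B_{m-1}` — finite posets with top elements `tᵢ` and nonnegative weights `wᵢ` satisfying Harris' inequality for up-sets —
the slot `U = {x | (∃ i, x.1 i = tᵢ) ∨ x.2 ∈ G}` of the pattern `(Π i, Bᵢ) × Q` with the product weight is an up-set, the weight
satisfies Harris' inequality, and `U` carries an exact flow certificate: induction on `m`, one principal block OR-step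
`…SahiE3BlockOrStep.cert_block_or_step` per block, Harris lifted by `harris_prod`, transport along
`(Π i : Fin (m+1), Bᵢ) × Q ≃o B₀ × ((Π i : Fin m, B_{i+1}) × Q)`.  With `Bᵢ = Bool^{kᵢ}` (product weights) and the trivial base this
is the certificate of every READ-ONCE DNF `⋁ᵢ ⋀_{j < kᵢ} x_{ij}` (next file); it contains `cert_dimer_over` (all `kᵢ = 2`) and the
hitting-set certificates (all `kᵢ = 1`).  HOME prim-l12-p4/FROM-prim-l12-p4-gen15-BLOCK-OR-STEP.md.
-/

namespace Summit.CriticalPhenomena.PercolationContinuityZ3.Theorems.SahiE3BlocksOver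

open Finset SahiE3BlockOrStep SahiE3ProductSections SahiE3LroTransport
open scoped BigOperators

universe u

/-- **The certificate of `⋁ᵢ (x_{Bᵢ} = ⊤) ∨ G` over a certified base**, by induction on the number of blocks (see the module
docstring). [this work] -/
theorem cert_blocks_over {Q : Type*} [Fintype Q] [DecidableEq Q] [PartialOrder Q] {νQ : Q → ℝ} (hνQ : ∀ q, 0 ≤ νQ q)
    (hHQ : ∀ S S' : Finset Q, IsUpperSet (S : Set Q) → IsUpperSet (S' : Set Q) →
      (∑ t ∈ S, νQ t) * (∑ t ∈ S', νQ t) ≤ (∑ t, νQ t) * ∑ t ∈ S ∩ S', νQ t)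
    (G : Finset Q) (hG : IsUpperSet (G : Set Q)) (RQ : Q → ℝ) (FlQ : Q → Q → ℝ)
    (g1 : ∀ t ∈ G, 0 ≤ RQ t) (g2 : ∀ t s, 0 ≤ FlQ t s) (g3 : ∀ t s, FlQ t s ≠ 0 → s ≤ t)
    (g4 : ∀ t ∈ G, RQ t + ∑ s ∈ Gᶜ, FlQ t s ≤ (∑ r, νQ r) * ((∑ r, νQ r) + ∑ r ∈ Gᶜ, νQ r) * νQ t)
    (g5 : ∀ s ∈ Gᶜ, ∑ t ∈ G, FlQ t s = (∑ r, νQ r) * (∑ r ∈ G, νQ r) * νQ s)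
    (g6 : ∀ S S' : Finset Q, IsUpperSet (S : Set Q) → IsUpperSet (S' : Set Q) →
      (∑ r, νQ r) * ((∑ t ∈ S, νQ t) * (∑ t ∈ S' ∩ G, νQ t) + (∑ t ∈ S', νQ t) * (∑ t ∈ S ∩ G, νQ t))
          - (∑ r ∈ G, νQ r) * (∑ t ∈ S, νQ t) * (∑ t ∈ S', νQ t) ≤ ∑ t ∈ (S ∩ S') ∩ G, RQ t) :
    ∀ (m : ℕ) (B : Fin m → Type u) [∀ i, Fintype (B i)] [∀ i, DecidableEq (B i)] [∀ i, PartialOrder (B i)]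
      (t : ∀ i, B i) (_ht : ∀ i (b : B i), b ≤ t i) (w : ∀ i, B i → ℝ) (_hw : ∀ i (b : B i), 0 ≤ w i b)
      (_hHB : ∀ i, ∀ I J : Finset (B i), IsUpperSet (I : Set (B i)) → IsUpperSet (J : Set (B i)) →
        (∑ b ∈ I, w i b) * (∑ b ∈ J, w i b) ≤ (∑ b, w i b) * ∑ b ∈ I ∩ J, w i b)
      (ν : ((∀ i, B i) × Q) → ℝ) (_hν : ∀ x, ν x = (∏ i, w i (x.1 i)) * νQ x.2)
      (U : Finset ((∀ i, B i) × Q)) (_hU : ∀ x, x ∈ U ↔ ((∃ i, x.1 i = t i) ∨ x.2 ∈ G)),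
    IsUpperSet (U : Set ((∀ i, B i) × Q)) ∧
    (∀ S S' : Finset ((∀ i, B i) × Q), IsUpperSet (S : Set ((∀ i, B i) × Q)) →
      IsUpperSet (S' : Set ((∀ i, B i) × Q)) →
      (∑ x ∈ S, ν x) * (∑ x ∈ S', ν x) ≤ (∑ x, ν x) * ∑ x ∈ S ∩ S', ν x) ∧
    ∃ (R : ((∀ i, B i) × Q) → ℝ) (Fl : ((∀ i, B i) × Q) → ((∀ i, B i) × Q) → ℝ),
      (∀ x ∈ U, 0 ≤ R x) ∧ (∀ x y, 0 ≤ Fl x y) ∧ (∀ x y, Fl x y ≠ 0 → y ≤ x) ∧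
      (∀ x ∈ U, R x + ∑ y ∈ Uᶜ, Fl x y ≤ (∑ r, ν r) * ((∑ r, ν r) + ∑ r ∈ Uᶜ, ν r) * ν x) ∧
      (∀ y ∈ Uᶜ, ∑ x ∈ U, Fl x y = (∑ r, ν r) * (∑ r ∈ U, ν r) * ν y) ∧
      (∀ S S' : Finset ((∀ i, B i) × Q), IsUpperSet (S : Set ((∀ i, B i) × Q)) →
        IsUpperSet (S' : Set ((∀ i, B i) × Q)) →
        (∑ r, ν r) * ((∑ x ∈ S, ν x) * (∑ x ∈ S' ∩ U, ν x) + (∑ x ∈ S', ν x) * (∑ x ∈ S ∩ U, ν x))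
          - (∑ r ∈ U, ν r) * (∑ x ∈ S, ν x) * (∑ x ∈ S', ν x) ≤ ∑ x ∈ (S ∩ S') ∩ U, R x) := by
  intro m
  induction m with
  | zero =>
    intro B _ _ _ t ht w hw hHB ν hν U hU
    let e : Q ≃o ((∀ i : Fin 0, B i) × Q) :=
      { toFun := fun q => (fun i => Fin.elim0 i, q)
        invFun := fun x => x.2
        left_inv := fun q => rfl
        right_inv := fun x => by
          rcases x with ⟨f, q⟩
          simp only [Prod.mk.injEq, and_true]
          funext i; exact Fin.elim0 i
        map_rel_iff' := by
          intro q q'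
          constructor
          · intro h; exact h.2
          · intro h; exact ⟨fun i => Fin.elim0 i, h⟩ }
    have hes : ∀ x : (∀ i : Fin 0, B i) × Q, e.symm x = x.2 := fun x => rfl
    have hνe : ∀ x : (∀ i : Fin 0, B i) × Q, ν x = νQ (e.symm x) := fun x => by
      rw [hes, hν, Finset.univ_eq_empty, Finset.prod_empty, one_mul]
    have hUe : ∀ x : (∀ i : Fin 0, B i) × Q, x ∈ U ↔ e.symm x ∈ G := fun x => by
      rw [hes, hU]
      constructor
      · rintro (⟨i, -⟩ | h)
        · exact Fin.elim0 i
        · exact h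
      · intro h; exact Or.inr h
    refine ⟨?_, harris_transport e _ hνe hHQ, cert_transport e g1 g2 g3 g4 g5 g6 _ hνe U hUe⟩
    intro x y hxy hx
    simp only [Finset.mem_coe] at hx ⊢
    rw [hUe] at hx ⊢
    exact hG (show e.symm x ≤ e.symm y from (Prod.mk_le_mk.1 hxy).2) hx
  | succ n ih =>
    intro B _ _ _ t ht w hw hHB ν hν U hU
    -- the tail: blocks `B 1, …, B n` over the base
    obtain ⟨G', hG'⟩ : ∃ V : Finset ((∀ i : Fin n, B i.succ) × Q), ∀ x, x ∈ V ↔ ((∃ i, x.1 i = t i.succ) ∨ x.2 ∈ G) :=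
      ⟨univ.filter fun x => (∃ i, x.1 i = t i.succ) ∨ x.2 ∈ G, fun x => by simp⟩
    obtain ⟨ν', hν'⟩ : ∃ f : (∀ i : Fin n, B i.succ) × Q → ℝ, ∀ x, f x = (∏ i, w i.succ (x.1 i)) * νQ x.2 :=
      ⟨_, fun _ => rfl⟩
    obtain ⟨hG'up, hH', R', Fl', c1, c2, c3, c4, c5, c6⟩ :=
      ih (fun i => B i.succ) (fun i => t i.succ) (fun i b => ht _ _) (fun i => w i.succ) (fun i b => hw _ _)
        (fun i => hHB i.succ) ν' hν' G' hG'
    have hν'0 : ∀ x, 0 ≤ ν' x := fun x => by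
      rw [hν']; exact mul_nonneg (Finset.prod_nonneg fun i _ => hw _ _) (hνQ _)
    -- the layered weight on `B 0 × tail`
    obtain ⟨ν₂, hν₂⟩ : ∃ f : B 0 × ((∀ i : Fin n, B i.succ) × Q) → ℝ, ∀ y, f y = w 0 y.1 * ν' y.2 := ⟨_, fun _ => rfl⟩
    have hH₂ := harris_prod (hw 0) hν'0 (hHB 0) hH' ν₂ (fun y => by rw [hν₂])
    -- `(Π i : Fin (n+1), B i) × Q ≃o B 0 × ((Π i : Fin n, B i.succ) × Q)`
    let e : (B 0 × ((∀ i : Fin n, B i.succ) × Q)) ≃o ((∀ i : Fin (n + 1), B i) × Q) :=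
      { toFun := fun y => (Fin.cons y.1 y.2.1, y.2.2)
        invFun := fun x => (x.1 0, (Fin.tail x.1, x.2))
        left_inv := fun y => by simp
        right_inv := fun x => by simp
        map_rel_iff' := by
          rintro ⟨b, f, q⟩ ⟨b', f', q'⟩
          simp only [Equiv.coe_fn_mk, Prod.mk_le_mk]
          rw [Pi.le_def, Fin.forall_iff_succ, Pi.le_def]
          simp only [Fin.cons_zero, Fin.cons_succ]
          tauto }
    have hes : ∀ x : (∀ i : Fin (n + 1), B i) × Q, e.symm x = (x.1 0, (Fin.tail x.1, x.2)) := fun x => rfl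
    have hνe : ∀ x : (∀ i : Fin (n + 1), B i) × Q, ν x = ν₂ (e.symm x) := fun x => by
      rw [hes, hν₂, hν, Fin.prod_univ_succ, hν']
      simp only [Fin.tail]
      ring
    -- the principal block OR-step on the head block
    obtain ⟨U₂, hU₂⟩ : ∃ V : Finset (B 0 × ((∀ i : Fin n, B i.succ) × Q)), ∀ y, y ∈ V ↔ (y.1 = t 0 ∨ y.2 ∈ G') :=
      ⟨univ.filter fun y => y.1 = t 0 ∨ y.2 ∈ G', fun y => by simp⟩
    obtain ⟨R₂, Fl₂, d1, d2, d3, d4, d5, d6⟩ := cert_block_or_step (ht 0) (hw 0) (hHB 0) hν'0 hH' G' hG'up R' Fl'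
      c1 c2 c3 c4 c5 c6 ν₂ (fun b s => by rw [hν₂]) U₂ hU₂
    have hUe : ∀ x : (∀ i : Fin (n + 1), B i) × Q, x ∈ U ↔ e.symm x ∈ U₂ := fun x => by
      rw [hU, hes, hU₂, hG', Fin.exists_fin_succ]
      simp only [Fin.tail, or_assoc]
    refine ⟨?_, harris_transport e _ hνe hH₂, cert_transport e d1 d2 d3 d4 d5 d6 _ hνe U hUe⟩
    intro x y hxy hx
    simp only [Finset.mem_coe] at hx ⊢
    rw [hU] at hx ⊢
    have hxy' : x.1 ≤ y.1 ∧ x.2 ≤ y.2 := Prod.mk_le_mk.1 (by simpa using hxy)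
    rcases hx with ⟨i, hi⟩ | hx2
    · exact Or.inl ⟨i, le_antisymm (ht i _) (hi ▸ hxy'.1 i)⟩
    · exact Or.inr (hG hxy'.2 hx2)

end Summit.CriticalPhenomena.PercolationContinuityZ3.Theorems.SahiE3BlocksOver
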